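import Mathlib.Analysis.SpecialFunctions.Pow.Real
import Summits.KontsevichZagierPeriods.KontsevichZagierPeriods.Theorems.SymplecticScissorsVolumeFormOffPlaneSimplexToBox
import Summits.KontsevichZagierPeriods.KontsevichZagierPeriods.Theorems.SymplecticScissorsVolumeFormOffPlaneSimplexExists
import Summits.KontsevichZagierPeriods.KontsevichZagierPeriods.Theorems.SymplecticScissorsVolumeFormOffPlaneOrderCellPerm
import Summits.KontsevichZagierPeriods.KontsevichZagierPeriods.Theorems.SymplecticScissorsVolumeFormOffPlaneCubeDecomposition
import Summits.KontsevichZagierPeriods.KontsevichZagierPeriods.Theorems.SymplecticScissorsVolumeFormOffPlaneCumprodMove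
import Summits.KontsevichZagierPeriods.KontsevichZagierPeriods.Theorems.SymplecticScissorsVolumeFormOffPlaneTriExists

/-!
# Crux `VolumeFormOffPlane` (stmt-KontsevichZagierPeriods-14935) — line `Sketch`,
stub `stub_binomialCellToBox` (every binomial cell is a box, every dimension)

Box-dimension `n + 1` (total `n + 2`), box coordinates `x_j = p (Fin.castSucc j)`, slack
`z = p (Fin.last (n + 1))`. For `M ∈ ℤ^{(n+1)×(n+1)}` with `det M ≠ 0` the BINOMIAL CELL
`{x > 0, a_k < ∏_j x_j^{M k j}, ∏_k ∏_j x_j^{M k j} < c, slack}` is the preimage of the log-simplex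
`S(a; c)` under the matrix power move `Φ_M(x, z) = (x^M, z·∏x/∏x^M)` (in logarithmic coordinates
the simplex `M⁻¹ · {u > log a, ∑ u < log c}`: these are all simplices with rational facet normals).
`stub_binomialCellToBox`: GIVEN the registered stub `stub_matrixPowerMove`, the cell is
KZ-equivalent to the corner-`1` log-box with edge ratios `(g^{1/(|det M|·(n+1)!)}, g, …, g)`,
`g = c / ∏ a`. Chain in `FormalRep ⧸ relations` (`d = |det M|`): `d • [cell] = [S(a; c)]` (power
move), `[S(a; c)] = [box_a(g^{1/(n+1)!}, g, …, g)]` (landed `stub_simplexToBox` fed with its four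
landed stubs), `= [box_1(…)]` (landed scaling move), `= d • [box_1(g^{1/(d (n+1)!)}, g, …, g)]`
(landed `toric_pow`), and `FormalRep ⧸ relations` is torsion-free (landed).

Sources: M. Kontsevich, D. Zagier, *Periods* (2001), §1.2 (the moves); bookkeeping folklore.
-/

noncomputable section

open MeasureTheory Set MvPolynomial
open Literature.NumberTheory.Transcendental Literature.ModelTheory.ExponentialFields

namespace Summit.KontsevichZagierPeriods.SymplecticScissors.LogPolytope

/-! ## The log-simplex over an arbitrary positive real-algebraic corner -/

/-- The log-simplex `S(a; c)` is `ℚ`-semialgebraic for real-algebraic `a`, `c`. [folklore] -/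
theorem bcb_isSemialgebraic_simplex {N : ℕ} {a : Fin N → ℝ} {c : ℝ} (haa : ∀ ι, IsAlgebraic ℚ (a ι))
    (hca : IsAlgebraic ℚ c) :
    IsSemialgebraic ℚ {p : Fin (N + 1) → ℝ | (∀ ι : Fin N, a ι < p (Fin.castSucc ι)) ∧
      ∏ ι : Fin N, p (Fin.castSucc ι) < c ∧ 0 < p (Fin.last N) ∧
      p (Fin.last N) * ∏ ι : Fin N, p (Fin.castSucc ι) < 1} := by
  have hbox : IsSemialgebraic ℚ (⋂ ι ∈ (Finset.univ : Finset (Fin N)),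
      {p : Fin (N + 1) → ℝ | a ι < p (Fin.castSucc ι)}) :=
    IsSemialgebraic.biInter _ _ fun ι _ => KZ.isSemialgebraic_setOf_const_lt_apply (haa ι) _
  have hprod := tre_isSemialgebraic_setOf_aeval_lt_const
    (∏ ι : Fin N, X (Fin.castSucc ι) : MvPolynomial (Fin (N + 1)) ℚ) hca
  have hslack := sxe_isSemialgebraic_slack N
  have hset : {p : Fin (N + 1) → ℝ | (∀ ι : Fin N, a ι < p (Fin.castSucc ι)) ∧
      ∏ ι : Fin N, p (Fin.castSucc ι) < c ∧ 0 < p (Fin.last N) ∧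
      p (Fin.last N) * ∏ ι : Fin N, p (Fin.castSucc ι) < 1} =
      ((⋂ ι ∈ (Finset.univ : Finset (Fin N)), {p : Fin (N + 1) → ℝ | a ι < p (Fin.castSucc ι)}) ∩
        {x : Fin (N + 1) → ℝ | aeval x (∏ ι : Fin N, X (Fin.castSucc ι) : MvPolynomial (Fin (N + 1)) ℚ) < c}) ∩
        {p : Fin (N + 1) → ℝ | 0 < p (Fin.last N) ∧ p (Fin.last N) * ∏ ι : Fin N, p (Fin.castSucc ι) < 1} := by
    ext p
    simp only [mem_setOf_eq, mem_inter_iff, mem_iInter, Finset.mem_univ, forall_const, map_prod,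
      aeval_X, and_assoc]
  rw [hset]
  exact (hbox.inter hprod).inter hslack

/-- The log-simplex `S(a; c)` over a positive corner lies in a compact box: `x_ι ≤ a_ι · (c / ∏ a)`
(each `x_κ / a_κ ≥ 1`, their product is `< c / ∏ a`) and `z ≤ (∏ a)⁻¹`. [folklore] -/
theorem bcb_simplex_subset_Icc {N : ℕ} {a : Fin N → ℝ} {c : ℝ} (ha : ∀ ι, 0 < a ι) :
    {p : Fin (N + 1) → ℝ | (∀ ι : Fin N, a ι < p (Fin.castSucc ι)) ∧
      ∏ ι : Fin N, p (Fin.castSucc ι) < c ∧ 0 < p (Fin.last N) ∧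
      p (Fin.last N) * ∏ ι : Fin N, p (Fin.castSucc ι) < 1} ⊆
    Icc (0 : Fin (N + 1) → ℝ) (Fin.snoc (fun ι => a ι * (c / ∏ κ, a κ)) (∏ κ, a κ)⁻¹) := by
  rintro p ⟨hbox, hc, hz, hprod⟩
  have hP : 0 < ∏ κ, a κ := Finset.prod_pos fun κ _ => ha κ
  have hx : ∀ ι, 0 < p (Fin.castSucc ι) := fun ι => (ha ι).trans (hbox ι)
  have hPle : ∏ κ, a κ ≤ ∏ κ, p (Fin.castSucc κ) :=
    Finset.prod_le_prod (fun κ _ => (ha κ).le) fun κ _ => (hbox κ).le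
  have hzle : p (Fin.last N) ≤ (∏ κ, a κ)⁻¹ := by
    rw [le_inv_comm₀ hz hP]
    have h1 : p (Fin.last N) * ∏ κ, a κ < 1 :=
      (mul_le_mul_of_nonneg_left hPle hz.le).trans_lt hprod
    rw [← one_div, le_div_iff₀ hz]
    linarith [mul_comm (p (Fin.last N)) (∏ κ, a κ)]
  -- the ratios `y_κ = x_κ / a_κ ≥ 1`
  have hy1 : ∀ κ, 1 ≤ p (Fin.castSucc κ) / a κ := fun κ => by
    rw [le_div_iff₀ (ha κ), one_mul]; exact (hbox κ).le
  have hyprod : ∏ κ, p (Fin.castSucc κ) / a κ < c / ∏ κ, a κ := by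
    rw [Finset.prod_div_distrib]
    exact (div_lt_div_iff_of_pos_right hP).mpr hc
  have hxle : ∀ ι, p (Fin.castSucc ι) ≤ a ι * (c / ∏ κ, a κ) := by
    intro ι
    have hsingle : p (Fin.castSucc ι) / a ι ≤ ∏ κ, p (Fin.castSucc κ) / a κ := by
      rw [← Finset.mul_prod_erase Finset.univ (fun κ => p (Fin.castSucc κ) / a κ) (Finset.mem_univ ι)]
      have h1 : 1 ≤ ∏ κ ∈ Finset.univ.erase ι, p (Fin.castSucc κ) / a κ :=
        Finset.one_le_prod fun κ _ => hy1 κ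
      have h0 : 0 ≤ p (Fin.castSucc ι) / a ι := (zero_le_one.trans (hy1 ι))
      nlinarith
    have := hsingle.trans hyprod.le
    rwa [div_le_iff₀ (ha ι), mul_comm] at this
  constructor
  · intro i
    induction i using Fin.lastCases with
    | last => simpa using hz.le
    | cast ι => simpa using (hx ι).le
  · intro i
    induction i using Fin.lastCases with
    | last => simpa using hzle
    | cast ι => simpa using hxle ι

/-- An integrand-`1` representation on the log-simplex `S(a; c)` exists (semialgebraic and
bounded; `KZ.exists_oneRep`). [folklore] -/
theorem bcb_exists_simplexRep {N : ℕ} {a : Fin N → ℝ} {c : ℝ} (ha : ∀ ι, 0 < a ι)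
    (haa : ∀ ι, IsAlgebraic ℚ (a ι)) (hca : IsAlgebraic ℚ c) :
    ∃ r : KZ.IntegralRep (N + 1), r.domain = {p : Fin (N + 1) → ℝ |
      (∀ ι : Fin N, a ι < p (Fin.castSucc ι)) ∧ ∏ ι : Fin N, p (Fin.castSucc ι) < c ∧
      0 < p (Fin.last N) ∧ p (Fin.last N) * ∏ ι : Fin N, p (Fin.castSucc ι) < 1} ∧
      r.integrand = fun _ => 1 :=
  KZ.exists_oneRep (bcb_isSemialgebraic_simplex haa hca)
    (((measure_mono (bcb_simplex_subset_Icc (c := c) ha)).trans_lt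
      isCompact_Icc.measure_lt_top).ne)

/-! ## The stub -/

/-- **Stub (lead; every binomial cell is a box).** Given `stub_matrixPowerMove`: for
`M ∈ ℤ^{(n+1)×(n+1)}`, `det M ≠ 0`, positive real-algebraic `a`, real-algebraic `c` with `∏ a < c`,
the binomial cell `{x > 0, a_k < ∏_j x_j^{M k j}, ∏_k ∏_j x_j^{M k j} < c}` (with slack) is
KZ-equivalent to the corner-`1` log-box with edge ratios `(g^{1/(|det M|·(n+1)!)}, g, …, g)`,
`g = c / ∏ a`: `|det M| • [cell] = [S(a; c)]` (power move), `[S(a; c)] = [box_a(g^{1/(n+1)!}, g, …)]`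
(landed `stub_simplexToBox`), scaling to the corner `1`, box stacking (landed `toric_pow`) and
torsion-freeness. [folklore] -/
theorem stub_binomialCellToBox : (∀ (n : ℕ) (M : Matrix (Fin n) (Fin n) ℤ), M.det ≠ 0 → (∀ (r' : KZ.IntegralRep (n + 1)), r'.domain ⊆ {p | ∀ ι : Fin (n), 0 < p (Fin.castSucc ι)} → (∀ p ∈ r'.domain, r'.integrand p = 1) → ∃ r : KZ.IntegralRep (n + 1), r.domain = {p : Fin (n + 1) → ℝ | (∀ ι : Fin n, 0 < p (Fin.castSucc ι)) ∧ (Fin.snoc (fun k : Fin (n) => ∏ j : Fin (n), p (Fin.castSucc j) ^ (M k j)) (p (Fin.last (n)) * (∏ j : Fin (n), p (Fin.castSucc j)) / ∏ k : Fin (n), ∏ j : Fin (n), p (Fin.castSucc j) ^ (M k j)) : Fin ((n) + 1) → ℝ) ∈ r'.domain} ∧ r.integrand = fun _ => 1) ∧ (∀ (r r' : KZ.IntegralRep (n + 1)), r.domain ⊆ {p | ∀ ι : Fin (n), 0 < p (Fin.castSucc ι)} → r'.domain ⊆ {p | ∀ ι : Fin (n), 0 < p (Fin.castSucc ι)} →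 (∀ p : Fin (n + 1) → ℝ, (∀ ι : Fin n, 0 < p (Fin.castSucc ι)) → (p ∈ r.domain ↔ (Fin.snoc (fun k : Fin (n) => ∏ j : Fin (n), p (Fin.castSucc j) ^ (M k j)) (p (Fin.last (n)) * (∏ j : Fin (n), p (Fin.castSucc j)) / ∏ k : Fin (n), ∏ j : Fin (n), p (Fin.castSucc j) ^ (M k j)) : Fin ((n) + 1) → ℝ) ∈ r'.domain)) → (∀ p ∈ r.domain, r.integrand p = 1) → (∀ p ∈ r'.domain, r'.integrand p = 1) → KZ.of r' - M.det.natAbs • KZ.of r ∈ KZ.relations)) → (∀ (n : ℕ) (M : Matrix (Fin (n + 1)) (Fin (n + 1)) ℤ) (a : Fin (n + 1) → ℝ) (c : ℝ), M.det ≠ 0 → (∀ ι, 0 < a ι) → (∀ ι, IsAlgebraic ℚ (a ι)) → IsAlgebraic ℚ c → ∏ ι, a ι < c → ∀ (r r' : KZ.IntegralRep (n + 1 + 1)), r.domain = {p : Fin ((n + 1) + 1) → ℝ | (∀ ι : Fin (n + 1), 0 < p (Fin.castSucc ι)) ∧ (∀ k : Fin (n + 1), (a) k < ∏ j : Fin (n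 + 1), p (Fin.castSucc j) ^ (M k j)) ∧ ∏ k : Fin (n + 1), ∏ j : Fin (n + 1), p (Fin.castSucc j) ^ (M k j) < c ∧ 0 < p (Fin.last (n + 1)) ∧ p (Fin.last (n + 1)) * ∏ ι : Fin (n + 1), p (Fin.castSucc ι) < 1} → r'.domain = {p : Fin ((n + 1) + 1) → ℝ | (∀ ι : Fin (n + 1), (fun _ => (1:ℝ)) ι < p (Fin.castSucc ι) ∧ p (Fin.castSucc ι) < (Function.update (fun _ : Fin (n + 1) => c / ∏ κ, a κ) 0 ((c / ∏ κ, a κ) ^ (((M.det.natAbs * (n + 1).factorial : ℕ) : ℝ)⁻¹))) ι) ∧ 0 < p (Fin.last (n + 1)) ∧ p (Fin.last (n + 1)) * ∏ ι : Fin (n + 1), p (Fin.castSucc ι) < 1} → (∀ p ∈ r.domain, r.integrand p = 1) → (∀ p ∈ r'.domain, r'.integrand p = 1) → KZ.of r - KZ.of r' ∈ KZ.relations) := by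
  intro hMP n M a c hM ha haa hca hlt r r' hrd hr'd hr hr'
  -- integrand-one bookkeeping
  have hio : ∀ {N : ℕ} {s : KZ.IntegralRep N}, (s.integrand = fun _ => 1) →
      ∀ p ∈ s.domain, s.integrand p = 1 := fun h p _ => by rw [h]
  -- the parameters
  set P : ℝ := ∏ ι, a ι with hP
  have hP0 : 0 < P := Finset.prod_pos fun ι _ => ha ι
  have hPa : IsAlgebraic ℚ P := lbl_isAlgebraic_prod haa
  set g : ℝ := c / P with hg
  have hg1 : 1 < g := (one_lt_div hP0).mpr hlt
  have hg0 : 0 < g := one_pos.trans hg1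
  have hga : IsAlgebraic ℚ g := by rw [hg, div_eq_mul_inv]; exact hca.mul hPa.inv
  set d : ℕ := M.det.natAbs with hd
  have hd0 : d ≠ 0 := Int.natAbs_ne_zero.mpr hM
  set Nf : ℕ := (n + 1).factorial with hNf
  have hNf0 : Nf ≠ 0 := Nat.factorial_ne_zero _
  set D : ℕ := d * Nf with hD
  have hD0 : D ≠ 0 := mul_ne_zero hd0 hNf0
  set γ : ℝ := g ^ ((Nf : ℝ)⁻¹) with hγ
  have hγ1 : 1 < γ := Real.one_lt_rpow hg1 (by positivity)
  have hγa : IsAlgebraic ℚ γ :=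
    IsAlgebraic.of_pow (Nat.pos_of_ne_zero hNf0) (by rw [Real.rpow_inv_natCast_pow hg0.le hNf0]; exact hga)
  set γ' : ℝ := g ^ ((D : ℝ)⁻¹) with hγ'
  have hγ'1 : 1 < γ' := Real.one_lt_rpow hg1 (by positivity)
  have hγ'd : γ' ^ d = γ := by
    rw [hγ', hγ, ← Real.rpow_natCast, ← Real.rpow_mul hg0.le]
    congr 1
    rw [hD, Nat.cast_mul]
    field_simp
  have hγ'a : IsAlgebraic ℚ γ' :=
    IsAlgebraic.of_pow (Nat.pos_of_ne_zero hd0) (by rw [hγ'd]; exact hγa)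
  have hupa : ∀ j, IsAlgebraic ℚ (Function.update (fun _ : Fin (n + 1) => g) 0 γ j) :=
    toric_update_algebraic (fun _ => hga) 0 hγa
  -- the representations
  obtain ⟨Sa, hSad, hSai⟩ := bcb_exists_simplexRep (c := c) ha haa hca
  obtain ⟨Ba, hBad, hBai⟩ := stub_logBoxCut.1 (n + 1) a
    (fun ι => a ι * Function.update (fun _ : Fin (n + 1) => g) 0 γ ι) ha haa
    (fun ι => (haa ι).mul (hupa ι))
  obtain ⟨B1, hB1d, hB1i⟩ := stub_logBoxCut.1 (n + 1) (fun _ => (1:ℝ))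
    (Function.update (fun _ : Fin (n + 1) => g) 0 (γ' ^ d)) (fun _ => one_pos)
    (fun _ => isAlgebraic_one) (toric_update_algebraic (fun _ => hga) 0 (hγ'a.pow d))
  obtain ⟨B2, hB2d, hB2i⟩ := stub_logBoxCut.1 (n + 1) (fun _ => (1:ℝ))
    (Function.update (fun _ : Fin (n + 1) => g) 0 γ') (fun _ => one_pos)
    (fun _ => isAlgebraic_one) (toric_update_algebraic (fun _ => hga) 0 hγ'a)
  -- Step 1: the matrix power move `d • [cell] = [S(a; c)]`
  have h1 : KZ.of Sa - d • KZ.of r ∈ KZ.relations := by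
    refine (hMP (n + 1) M hM).2 r Sa ?_ ?_ (fun p hpos => ?_) hr (hio hSai)
    · rw [hrd]
      exact fun p hp => hp.1
    · rw [hSad]
      exact fun p hp ι => (ha ι).trans (hp.1 ι)
    · rw [hrd, hSad]
      simp only [mem_setOf_eq, Fin.snoc_castSucc, Fin.snoc_last]
      have hQ : 0 < ∏ k : Fin (n + 1), ∏ j : Fin (n + 1), p (Fin.castSucc j) ^ (M k j) :=
        Finset.prod_pos fun k _ => Finset.prod_pos fun j _ => zpow_pos (hpos j) _
      have hX : 0 < ∏ j : Fin (n + 1), p (Fin.castSucc j) := Finset.prod_pos fun j _ => hpos j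
      have e4 : 0 < p (Fin.last (n + 1)) * (∏ j, p (Fin.castSucc j)) /
          ∏ k, ∏ j, p (Fin.castSucc j) ^ (M k j) ↔ 0 < p (Fin.last (n + 1)) := by
        rw [div_pos_iff_of_pos_right hQ, mul_pos_iff_of_pos_right hX]
      have e5 : p (Fin.last (n + 1)) * (∏ j, p (Fin.castSucc j)) /
          (∏ k, ∏ j, p (Fin.castSucc j) ^ (M k j)) * ∏ k, ∏ j, p (Fin.castSucc j) ^ (M k j) =
          p (Fin.last (n + 1)) * ∏ j, p (Fin.castSucc j) := div_mul_cancel₀ _ hQ.ne'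
      rw [e4, e5]
      exact ⟨fun h => ⟨h.2.1, h.2.2.1, h.2.2.2.1, h.2.2.2.2⟩,
        fun h => ⟨hpos, h.1, h.2.1, h.2.2.1, h.2.2.2⟩⟩
  -- Step 2: the divided power `[S(a; c)] = [box_a(γ, g, …, g)]`
  have h2 : KZ.of Sa - KZ.of Ba ∈ KZ.relations :=
    stub_simplexToBox stub_simplexExists stub_orderCellPerm stub_cubeDecomposition stub_cumprodMove
      n a c ha haa hca hlt Sa Ba hSad hBad (hio hSai) (hio hBai)
  -- Step 3: scaling to the corner `1`
  have h3 : KZ.of B1 - KZ.of Ba ∈ KZ.relations := by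
    refine stub_logBoxLinear.1 (n + 1) (fun _ => (1:ℝ)) (Function.update (fun _ : Fin (n + 1) => g) 0 γ)
      a ha haa B1 Ba (by rw [hB1d, hγ'd]) ?_ (hio hB1i) (hio hBai)
    rw [hBad]
    ext p
    simp only [mem_setOf_eq, mul_one]
  -- Step 4: box stacking in coordinate `0`: `[box_1(γ, g, …)] = d • [box_1(γ', g, …)]`
  set π := QuotientAddGroup.mk' KZ.relations with hπ
  have e4 : π (KZ.of B1) = d • π (KZ.of B2) :=
    toric_pow stub_logBoxCut.1 stub_logBoxCut.2 stub_logBoxLinear.1 (fun _ => g) (fun _ => hga) 0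
      hγ'1 hγ'a B2 hB2d (hio hB2i) d B1 hB1d (hio hB1i)
  -- Step 5: divide by `d`
  have e1 : π (KZ.of Sa) = d • π (KZ.of r) := by
    rw [← map_nsmul]; exact toric_mk_eq_iff.mpr h1
  have e2 : π (KZ.of Sa) = π (KZ.of Ba) := toric_mk_eq_iff.mpr h2
  have e3 : π (KZ.of B1) = π (KZ.of Ba) := toric_mk_eq_iff.mpr h3
  have e5 : KZ.of r - KZ.of B2 ∈ KZ.relations := by
    refine Summit.KontsevichZagierPeriods.MultiplicationAccessible.Negative.mem_relations_of_nsmul_mem_relations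
      hd0 ?_
    rw [nsmul_sub]
    exact toric_mk_eq_iff.mp (by rw [map_nsmul, map_nsmul, ← e1, e2, ← e3, e4])
  -- Step 6: `B2` and `r'` have the same domain
  have e6 : KZ.of B2 - KZ.of r' ∈ KZ.relations :=
    toric_mk_eq_iff.mp (toric_mk_eq_of_domain_eq (by rw [hB2d, hr'd]) (hio hB2i) hr')
  have : KZ.of r - KZ.of r' = (KZ.of r - KZ.of B2) + (KZ.of B2 - KZ.of r') := by abel
  rw [this]
  exact KZ.relations.add_mem e5 e6

end Summit.KontsevichZagierPeriods.SymplecticScissors.LogPolytope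

end
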